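import Mathlib
import Summits.Ventures.PercRepro2.Defs
import Summits.Ventures.PercRepro2.Graph
import Summits.Ventures.PercRepro2.OneColourSwitch
import Summits.Ventures.PercRepro2.RegionHubSign
import Summits.Ventures.PercRepro2.SideSwitch
import Summits.Ventures.PercRepro2.SideSwitchFibre
import Summits.Ventures.PercRepro2.SideSwitchClosed
import Summits.Ventures.PercRepro2.SideSwitchComps

/-!
# The single-`d` class without a pocket — definitions (blind cell PercRepro2, p3 g20,
2026-08-27; `proofs/P3-CPNC.md` §17c)

For a finite marked multigraph and a non-mark `d`, the `m9` sign sum restricted to the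
`Sep`-colourings in which no vertex other than `r, s, d` is doubly reached from `{r, s}`
(`DOne`, the `|D₀| = 1` member of the cumulative family of §16h) is studied through the
two-colour worlds of `{r, s}` in the graph `G − d`, realised on the same edge type by turning
every edge at `d` into a loop (`endsD`, the device of `M9LoopTransfer`).  This file has the
looped graph and its transfer lemmas (`conn_of_conn_endsD`, `conn_endsD_of_eqOn`,
`not_mem_K2_endsD`), the monotone path-transfer lemma `conn_of_le_off_touches`, and the
objects of the fibration: the `T`-edges `Tset`, the flip `flipF` of a set of edges, the
coordinate assignment `assignX`, the source predicates `srcY` / `srcW`, the legal vectors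
`L4`, the representatives `RepD`, the doubly-reached-only-at-`d` predicate `DOne` and the
restricted sign sum `dSignSum`.  Own work; std axioms.
-/

namespace Summit.Ventures.PercRepro2

namespace NoPocket

open Finset Classical RegionHub OneColourSwitch SideSwitch

variable {V : Type*} {E : Type*}

section LoopedGraph

variable (ends : E → Sym2 V) (d : V)

/-- The graph `G − d` on the same edge type: every edge at `d` becomes a loop at `d`. -/
noncomputable def endsD : E → Sym2 V := fun e => if d ∈ ends e then s(d, d) else ends e

variable {ends d}

/-- `endsD` on an edge at `d`. -/
lemma endsD_of_mem {e : E} (h : d ∈ ends e) : endsD ends d e = s(d, d) := by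
  simp [endsD, h]

/-- `endsD` on an edge not at `d`. -/
lemma endsD_of_notMem {e : E} (h : d ∉ ends e) : endsD ends d e = ends e := by
  simp [endsD, h]

/-- An edge with ends `{u, v}` is not at `d` when `u, v ≠ d`. -/
lemma notMem_of_ends_ne {e : E} {u v : V} (hends : ends e = s(u, v)) (hu : u ≠ d) (hv : v ≠ d) :
    d ∉ ends e := by
  rw [hends, Sym2.mem_iff]
  rintro (rfl | rfl)
  · exact hu rfl
  · exact hv rfl

/-- Adjacency in the open subgraph of `G − d`: an open edge of `G` between two distinct
vertices other than `d`. -/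
lemma openGraph_endsD_adj {ω : Config E} {u v : V} :
    (openGraph (endsD ends d) ω).Adj u v ↔ u ≠ v ∧ u ≠ d ∧ v ≠ d ∧ OpenAdj ends ω u v := by
  rw [openGraph_adj]
  constructor
  · rintro ⟨huv, e, he, hends⟩
    by_cases hd : d ∈ ends e
    · rw [endsD_of_mem hd, Sym2.eq_iff] at hends
      exfalso
      rcases hends with ⟨h1, h2⟩ | ⟨h1, h2⟩
      · exact huv (h1.symm.trans h2)
      · exact huv (h2.symm.trans h1)
    · rw [endsD_of_notMem hd] at hends
      refine ⟨huv, ?_, ?_, e, he, hends⟩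
      · rintro rfl
        exact hd (by rw [hends]; exact Sym2.mem_mk_left _ _)
      · rintro rfl
        exact hd (by rw [hends]; exact Sym2.mem_mk_right _ _)
  · rintro ⟨huv, hud, hvd, e, he, hends⟩
    refine ⟨huv, e, he, ?_⟩
    rw [endsD_of_notMem (notMem_of_ends_ne hends hud hvd), hends]

/-- Connections in `G − d` are connections in `G`. -/
lemma conn_of_conn_endsD {ω : Config E} {u v : V} (h : Conn (endsD ends d) ω u v) :
    Conn ends ω u v := by
  refine mem_of_conn_of_closed (S := {w | Conn ends ω u w}) ?_ (conn_refl _ _ _) h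
  intro x hx y hxy
  obtain ⟨_, _, _, hadj⟩ := openGraph_endsD_adj.1 hxy
  exact conn_trans hx (conn_of_openAdj hadj)

/-- `d` is isolated in `G − d`. -/
lemma eq_of_conn_endsD_d {ω : Config E} {x : V} (h : Conn (endsD ends d) ω d x) : x = d := by
  have key : x ∈ {w | w = d} := by
    refine mem_of_conn_of_closed (S := {w | w = d}) ?_ rfl h
    intro a ha b hab
    obtain ⟨_, had, _, _⟩ := openGraph_endsD_adj.1 hab
    exact (had ha).elim
  exact key

/-- `d` lies in no world of `{r, s}` in `G − d`. -/
lemma not_mem_K2_endsD {r s : V} (hr : d ≠ r) (hs : d ≠ s) (ω : Config E) :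
    d ∉ K2 (endsD ends d) r s ω := by
  intro h
  rcases mem_K2_iff.1 h with hc | hc
  · exact hr (eq_of_conn_endsD_d (conn_symm hc)).symm
  · exact hs (eq_of_conn_endsD_d (conn_symm hc)).symm

/-- `d` lies in no `W`-world of `{r, s}` in `G − d`. -/
lemma not_mem_M2_endsD {r s : V} (hr : d ≠ r) (hs : d ≠ s) (ω : Config E) :
    d ∉ M2 (endsD ends d) r s ω :=
  not_mem_K2_endsD hr hs (OneColourSwitch.compl ω)

/-- Connectivity in `G − d` only sees the edges not at `d`. -/
lemma conn_endsD_of_eqOn {ω ω' : Config E} (h : ∀ e, d ∉ ends e → ω e = ω' e) {u v : V}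
    (hc : Conn (endsD ends d) ω u v) : Conn (endsD ends d) ω' u v := by
  refine mem_of_conn_of_closed (S := {w | Conn (endsD ends d) ω' u w}) ?_ (conn_refl _ _ _) hc
  intro x hx y hxy
  obtain ⟨_, hxd, hyd, e, he, hends⟩ := openGraph_endsD_adj.1 hxy
  have hd : d ∉ ends e := notMem_of_ends_ne hends hxd hyd
  refine conn_trans hx (conn_of_openAdj ⟨e, ?_, ?_⟩)
  · rw [← h e hd]; exact he
  · rw [endsD_of_notMem hd]; exact hends

/-- Connectivity in `G − d` only sees the edges not at `d` (both directions). -/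
lemma conn_endsD_iff_of_eqOn {ω ω' : Config E} (h : ∀ e, d ∉ ends e → ω e = ω' e) {u v : V} :
    Conn (endsD ends d) ω u v ↔ Conn (endsD ends d) ω' u v :=
  ⟨conn_endsD_of_eqOn h, conn_endsD_of_eqOn (fun e he => (h e he).symm)⟩

/-- The `Y`-world of `{r, s}` in `G − d` only sees the edges not at `d`. -/
lemma K2_endsD_eq_of_eqOn {ω ω' : Config E} (h : ∀ e, d ∉ ends e → ω e = ω' e) (r s : V) :
    K2 (endsD ends d) r s ω = K2 (endsD ends d) r s ω' := by
  ext x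
  simp only [mem_K2_iff, conn_endsD_iff_of_eqOn h]

/-- The `W`-world of `{r, s}` in `G − d` only sees the edges not at `d`. -/
lemma M2_endsD_eq_of_eqOn {ω ω' : Config E} (h : ∀ e, d ∉ ends e → ω e = ω' e) (r s : V) :
    M2 (endsD ends d) r s ω = M2 (endsD ends d) r s ω' := by
  rw [← K2_compl, ← K2_compl]
  exact K2_endsD_eq_of_eqOn (fun e he => by simp [OneColourSwitch.compl, h e he]) r s

/-- A connection of `G − d` avoids `d`: every vertex joined in `G − d` to a vertex other than
`d` is not `d`. -/
lemma ne_d_of_conn_endsD {ω : Config E} {u v : V} (hu : u ≠ d) (h : Conn (endsD ends d) ω u v) :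
    v ≠ d := by
  rintro rfl
  exact hu (eq_of_conn_endsD_d (conn_symm h))

end LoopedGraph

section PathTransfer

variable {ends : E → Sym2 V}

/-- **Monotone path transfer**: a connection of `ω` from a vertex outside the explored set of
`X` survives in any `ω'` that is open wherever `ω` is open off the edges touching that explored
set (the one-sided form of `conn_of_eqOn_notTouches`). -/
lemma conn_of_le_off_touches {X : Set V} {ω ω' : Config E} {a b : V} (ha : a ∉ expl ends X ω)
    (h : ∀ e ∉ touches ends (expl ends X ω), ω e = true → ω' e = true) (hc : Conn ends ω a b) :
    Conn ends ω' a b := by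
  have key : b ∈ {x | x ∉ expl ends X ω ∧ Conn ends ω' a x} := by
    refine mem_of_conn_of_closed (ends := ends) (ω := ω) ?_ ⟨ha, conn_refl _ _ _⟩ hc
    rintro x ⟨hxL, hxc⟩ y hxy
    obtain ⟨_, e, he, hends⟩ := openGraph_adj.1 hxy
    have hyL : y ∉ expl ends X ω := by
      intro hy
      exact hxL (expl_closed y hy x hxy.symm)
    have hnt : e ∉ touches ends (expl ends X ω) := by
      rintro ⟨x', hx', y', hends'⟩
      rw [hends, Sym2.eq_iff] at hends'
      rcases hends' with ⟨rfl, _⟩ | ⟨_, rfl⟩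
      · exact hxL hx'
      · exact hyL hx'
    exact ⟨hyL, conn_trans hxc (conn_of_openAdj ⟨e, h e hnt he, hends⟩)⟩
  exact key.2

end PathTransfer

section Objects

variable [Fintype V] [DecidableEq V] [Fintype E] [DecidableEq E]

variable (ends : E → Sym2 V)

/-- The `T`-edges: the edges between `d` and `r` or `s`. -/
noncomputable def Tset (d r s : V) : Finset E :=
  univ.filter (fun e => ends e = s(d, r) ∨ ends e = s(d, s))

/-- Flip the colour of every edge of `F`. -/
def flipF (F : Finset E) (ω : Config E) : Config E := fun e => if e ∈ F then !ω e else ω e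

/-- The coordinate assignment: the blocks of `x.1` on the `W`-side (every edge touching them
flipped, the edges to `d` included) and the `T`-edges of `x.2` coloured `W`. -/
noncomputable def assignX (x : Finset (Finset V) × Finset E) (ρ : Config E) : Config E :=
  flipTouch ends (↑(unionT x.1) : Set V) (flipF x.2 ρ)

/-- A block has a `Y` edge to `d` (in the representative). -/
def hasY (d : V) (ρ : Config E) (C : Finset V) : Prop :=
  ∃ e, ∃ y ∈ C, ends e = s(d, y) ∧ ρ e = true

/-- A block has a `W` edge to `d` (in the representative): a dead edge. -/
def hasW (d : V) (ρ : Config E) (C : Finset V) : Prop :=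
  ∃ e, ∃ y ∈ C, ends e = s(d, y) ∧ ρ e = false

/-- The blocks: the components of the sided set of `{r, s}` in `G − d`. -/
noncomputable def blocks (d r s : V) (ρ : Config E) : Finset (Finset V) :=
  comps (endsD ends d) r s ρ

/-- `d` has a `Y`-source in the assignment `x`: a `T`-edge left `Y`, or an `A`-side block with a
`Y` edge to `d`. -/
def srcY (d r s : V) (ρ : Config E) (x : Finset (Finset V) × Finset E) : Prop :=
  (∃ e ∈ Tset ends d r s, e ∉ x.2) ∨ ∃ C ∈ blocks ends d r s ρ, C ∉ x.1 ∧ hasY ends d ρ C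

/-- `d` has a `W`-source in the assignment `x`: a `T`-edge coloured `W`, or a `B`-side block
whose `Y` edge to `d` was flipped. -/
def srcW (d r s : V) (ρ : Config E) (x : Finset (Finset V) × Finset E) : Prop :=
  (∃ e ∈ x.2, e ∈ Tset ends d r s) ∨ ∃ C ∈ x.1, hasY ends d ρ C

/-- The legal coordinate vectors: a `W`-sourced `d` has no dead edge to an `A`-side block, a
`Y`-sourced `d` none to a `B`-side block. -/
noncomputable def L4 (d r s : V) (ρ : Config E) : Finset (Finset (Finset V) × Finset E) :=
  ((blocks ends d r s ρ).powerset ×ˢ (Tset ends d r s).powerset).filter (fun x =>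
    (srcW ends d r s ρ x → ∀ C ∈ blocks ends d r s ρ, C ∉ x.1 → ¬ hasW ends d ρ C) ∧
    (srcY ends d r s ρ x → ∀ C ∈ x.1, ¬ hasW ends d ρ C))

/-- The representatives: `Sep` in `G − d`, every block on the `Y`-side, every `T`-edge `Y`. -/
noncomputable def RepD (p q r s d : V) : Finset (Config E) :=
  univ.filter (fun ρ => sep2 (endsD ends d) p q r s ρ ∧
    (∀ y ∈ M2 (endsD ends d) r s ρ, y = r ∨ y = s) ∧ ∀ e ∈ Tset ends d r s, ρ e = true)

/-- No vertex other than `r, s, d` lies in both worlds of `{r, s}`. -/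
def DOne (r s d : V) (ω : Config E) : Prop :=
  ∀ x, x ≠ r → x ≠ s → x ≠ d → x ∈ K2 ends r s ω → x ∉ M2 ends r s ω

/-- The colourings of the restricted sum: `Sep` and doubly reached only at `d`. -/
noncomputable def DOneSet (p q r s d : V) : Finset (Config E) :=
  univ.filter (fun ω => sep2 ends p q r s ω ∧ DOne ends r s d ω)

/-- The `m9` sign sum over the `Sep`-colourings doubly reached only at `d`:
`Σ_{ω ∈ Sep, D(ω) ⊆ {d}} σ_pq · σ_rs`. -/
noncomputable def dSignSum (p q r s d : V) : ℤ :=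
  ∑ ω : Config E, if sep2 ends p q r s ω ∧ DOne ends r s d ω then
    sigma ends ω p q * sigma ends ω r s else 0

/-- The no-pocket hypothesis: every neighbour of `d` other than `r, s` (and `d`) is adjacent to
`r` or to `s`. -/
def NoPocketAt (d r s : V) : Prop :=
  ∀ e x, ends e = s(d, x) → x ≠ d → x ≠ r → x ≠ s →
    ∃ e', ends e' = s(x, r) ∨ ends e' = s(x, s)

variable {ends}

omit [Fintype V] [DecidableEq E] in
/-- Membership in `Tset`. -/
lemma mem_Tset {d r s : V} {e : E} :
    e ∈ Tset ends d r s ↔ ends e = s(d, r) ∨ ends e = s(d, s) := by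
  simp [Tset]

omit [Fintype V] [DecidableEq E] in
/-- A `T`-edge is at `d`. -/
lemma d_mem_of_mem_Tset {d r s : V} {e : E} (h : e ∈ Tset ends d r s) : d ∈ ends e := by
  rcases mem_Tset.1 h with h' | h' <;> rw [h'] <;> exact Sym2.mem_mk_left _ _

omit [Fintype E] in
/-- `flipF` on an edge of `F`. -/
lemma flipF_of_mem {F : Finset E} {ω : Config E} {e : E} (h : e ∈ F) : flipF F ω e = !ω e := by
  simp [flipF, h]

omit [Fintype E] in
/-- `flipF` on an edge not in `F`. -/
lemma flipF_of_notMem {F : Finset E} {ω : Config E} {e : E} (h : e ∉ F) : flipF F ω e = ω e := by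
  simp [flipF, h]

omit [Fintype E] in
/-- `flipF F` is an involution. -/
lemma flipF_flipF (F : Finset E) (ω : Config E) : flipF F (flipF F ω) = ω := by
  funext e
  by_cases h : e ∈ F
  · rw [flipF_of_mem h, flipF_of_mem h, Bool.not_not]
  · rw [flipF_of_notMem h, flipF_of_notMem h]

omit [Fintype E] in
/-- The colour flip commutes with `flipF`. -/
lemma compl_flipF (F : Finset E) (ω : Config E) :
    OneColourSwitch.compl (flipF F ω) = flipF F (OneColourSwitch.compl ω) := by
  funext e
  by_cases h : e ∈ F
  · simp [OneColourSwitch.compl, flipF_of_mem h]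
  · simp [OneColourSwitch.compl, flipF_of_notMem h]

/-- Membership in the representatives. -/
lemma mem_RepD {p q r s d : V} {ρ : Config E} :
    ρ ∈ RepD ends p q r s d ↔ sep2 (endsD ends d) p q r s ρ ∧
      (∀ y ∈ M2 (endsD ends d) r s ρ, y = r ∨ y = s) ∧ ∀ e ∈ Tset ends d r s, ρ e = true := by
  simp [RepD]

omit [Fintype V] [DecidableEq V] in
/-- Membership in `DOneSet`. -/
lemma mem_DOneSet {p q r s d : V} {ω : Config E} :
    ω ∈ DOneSet ends p q r s d ↔ sep2 ends p q r s ω ∧ DOne ends r s d ω := by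
  simp [DOneSet]

omit [DecidableEq E] in
/-- Membership in `L4`. -/
lemma mem_L4 {d r s : V} {ρ : Config E} {x : Finset (Finset V) × Finset E} :
    x ∈ L4 ends d r s ρ ↔ (x.1 ⊆ blocks ends d r s ρ ∧ x.2 ⊆ Tset ends d r s) ∧
      (srcW ends d r s ρ x → ∀ C ∈ blocks ends d r s ρ, C ∉ x.1 → ¬ hasW ends d ρ C) ∧
      (srcY ends d r s ρ x → ∀ C ∈ x.1, ¬ hasW ends d ρ C) := by
  simp only [L4, Finset.mem_filter, Finset.mem_product, Finset.mem_powerset]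

omit [Fintype V] [DecidableEq V] [Fintype E] [DecidableEq E] in
/-- `DOne` is invariant under the colour flip. -/
lemma DOne_compl {r s d : V} {ω : Config E} (h : DOne ends r s d ω) :
    DOne ends r s d (OneColourSwitch.compl ω) := by
  intro x hr hs hd hx hM
  rw [K2_compl] at hx
  rw [M2_compl] at hM
  exact h x hr hs hd hM hx

/-- The representative of a colouring: every `B`-side block of `G − d` switched to the `A`-side
(all edges touching it, the edges to `d` included) and every `T`-edge coloured `Y`. -/
noncomputable def repOf (d r s : V) (ω : Config E) : Config E :=
  flipTouch ends (↑(Bside (endsD ends d) r s ω) : Set V)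
    (flipF ((Tset ends d r s).filter (fun e => ω e = false)) ω)

/-- The coordinates of a colouring: its `B`-side blocks and its `W`-coloured `T`-edges. -/
noncomputable def coordsOf (d r s : V) (ω : Config E) : Finset (Finset V) × Finset E :=
  ((blocks ends d r s ω).filter (fun C => C ⊆ Bside (endsD ends d) r s ω),
    (Tset ends d r s).filter (fun e => ω e = false))

end Objects

end NoPocket

end Summit.Ventures.PercRepro2
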